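import Literature.NumberTheory.EllipticCurves.ModularCurveRealPeriodProofs
import Summits.BirchSwinnertonDyer.Rank1Residual.X4.KuriharaClasswideRankOne
import HarnessLib

/-!
# The period transfer at an ADDITIVE prime: `Ω(W) = |c| · Ω⁺_f` for an OPTIMAL parametrisation
# datum, and the Kim consumers of class X4 with the period binder discharged
# (cell `b2b-bsdres`, unit `b2b-bsdres-additive-p3`; sibling of `X4/KuriharaClasswide[RankOne].lean`)

HONEST FRAMING (run/shared/lean/b2b/bsd-rank1-residual/, verbatim in every file): the goal of the
cell is to DELETE the COMBINATION-SHAPED residual classes of the Birch–Swinnerton-Dyer formula for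
ALL analytic-rank `≤ 1` elliptic curves over `ℚ` — "full BSD formula for every rank `≤ 1` curve in
class `C`" assembled STRICTLY from published theorems — so that the rank-`≤ 1` remainder becomes
exactly the CONSTRUCTION-SHAPED classes, which are TYPED (missing-input `Prop`s), NOT attempted.
This is not "finishing BSD". Research route; no claim beyond the stated classes. X3 and X4 stay
CONSTRUCTION-SHAPED; nothing below is a class theorem closing either; per-pair shapes only.

## Why (referee R82.4 (iii))

Every Kim-type fact of the tree at a prime `p` (`KuriharaNumberKimShaLength`,
`KuriharaNumberKimCertificate`, …) carries the PERIOD-TRANSFER binder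
`∃ u : ℚ, |u|_p = 1 ∧ Ω(W) = u · Ω⁺_f` (it turns the tree's `Ω⁺_f`-normalised `kuriharaNumber` into
Kim's Néron-normalised `δ̃_n` up to a unit). At a GOOD or MULTIPLICATIVE `p ≥ 5` it is the named
fact `realPeriodRat_eq_unit_mul_plusPeriod[_of_multiplicative]` (Greenberg–Vatsal Rem. 3.4 +
Mazur / Abbes–Ullmo on the Manin constant). At an ADDITIVE prime (class X4) no such fact exists —
Kim's Manin hypothesis is genuinely needed there (§1.3.5) — but for the pairs the lane meets (all
curves `…1` = `X₀(N)`-OPTIMAL, `N < 2·10⁴`) the binder is ELEMENTARY: for an optimal datum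
(`Λ_E ⊆ c·Λ_f`, hence `Λ_E = c·Λ_f`) one has `Ω(W) = |c| · Ω⁺_f` EXACTLY (Cremona, *Algorithms*
§2.8 p. 26: "`Ω(f)/Ω₀(f)` is the number of components of the real locus … in each case `Ω(f)` is
twice the least real part of a period"; Edixhoven 1991 §1), so `u = |c|` and `|u|_p = 1 ⟺ p ∤ c`,
which is Kim's Manin hypothesis itself (and `|c| = 1` for `N ≤ 130000`, Agashe–Ribet–Stein 2006
Thm. 2.6, tree fact `AgasheRibetStein2006.cremona_abs_maninConstant_eq_one_of_level_le`). The tree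
proved only `m · Ω(W) = |c| · Ω⁺_f` with `0 < m` (`ModularParametrizationData.realPeriodRat_dvd_holds`);
this file proves `m = 1` under optimality.

## Contents (theorems only; our own work, hence `Summits/`)

* `isReal_I_mul_half_add_half_mem_of_discr_neg` — the missing real-lattice lemma: a real lattice
  `Λ` with `g₂³ − 27g₃² < 0` (one real component) is RHOMBIC, `iΩ₀'/2 + Ω₀/2 ∈ Λ` (Lawden §6.16;
  converse companion of the tree's `PeriodPair.IsReal.half_add_I_mul_half_notMem_of_discr_pos`):
  otherwise the horizontal line through `iΩ₀'/2` misses `Λ` and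
  `PeriodPair.IsReal.exists_Ioo_integral_eq_of_line` yields an interval `(m, M)`, `M ≤ e₁`, on
  which the cubic `4x³ − g₂x − g₃` is positive — impossible when `disc < 0` (the quadratic cofactor
  of `x − e₁` is then positive, so the cubic is negative left of `e₁`; the argument of the tree's
  `realPeriod_formula_eq`).
* `exists_mem_re_eq_realPeriodRat_div_two` — for any datum `D` of an elliptic `W/ℚ` some point of
  the Néron lattice `Λ_E` has real part `Ω(W)/2` (rectangular case: `Ω₀`, `Ω(W) = 2Ω₀`; rhombic
  case: the point above, `Ω(W) = Ω₀`), i.e. `re Λ_E = ℤ · Ω(W)/2` together with the tree's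
  `exists_re_eq_int_mul_realPeriodRat_div_two`.
* `realPeriodRat_eq_abs_maninConstant_mul_plusPeriod_of_optimal` — **`Ω(W) = |c| · Ω⁺_f` for an
  optimal datum**; `periodTransfer_of_optimal` — the Kim binder with `u = |c|` when `p ∤ c`.
* `bsdp_of_kim_rankZero_of_optimal`, `bsdp_of_kim_rankOne_of_optimal` — the any-reduction Kim
  consumers of `X4/KuriharaClasswide[RankOne].lean` with `hper` DISCHARGED by optimality: per pair
  the remaining non-certificate inputs are exactly "`D` optimal with `p ∤ D.c`" (the shape of
  `AgasheRibetStein2006.cremona_optimal_curveOne` + Thm. 2.6 for the census classes) — R82.4 (ii).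

References: Cremona, *Algorithms for Modular Elliptic Curves* (2nd ed. 1997) §2.8 (p. 26), §2.10
[CremonaAlgorithms1997]; Edixhoven, Progr. Math. 89 (1991) §1 [EdixhovenManin1991]; Lawden,
*Elliptic Functions and Applications* (1989) §6.16 [Lawden1989]; Kim, Amer. J. Math. 148 (2026)
§1.3.5, Thm. 1.8 [Kim2022StructureSelmer]; Agashe–Ribet–Stein, PAMQ 2 (2006) Thm. 2.6
[AgasheRibetStein2006]; cell file REFEREE.md R82.4.
-/

noncomputable section

open scoped Classical MatrixGroups ModularForm ComplexConjugate

open Complex CongruenceSubgroup WeierstrassCurve Literature.NumberTheory.EllipticCurves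
  Literature.NumberTheory.EllipticCurves.ModularForms
  Literature.NumberTheory.EllipticCurves.Rank1Residual
  Literature.NumberTheory.EllipticCurves.Rank1Residual.Typed

namespace Summit.BirchSwinnertonDyer.Rank1Residual.X4

/-! ### §1 Real lattices with negative discriminant are rhombic -/

/-- **A real lattice with `g₂³ − 27g₃² < 0` is rhombic: `iΩ₀'/2 + Ω₀/2 ∈ Λ`** (`Ω₀`, `Ω₀'` the least
positive real periods of `Λ` and `iΛ`; Lawden §6.16: `disc < 0` is the case of one pair of complex
conjugate roots, `E_Λ(ℝ)` connected). If not, the line `iΩ₀'/2 + ℝ` misses `Λ` (as in the tree's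
`PeriodPair.IsReal.integral_inv_sqrt_cubic_of_discr_pos_eq`, rectangular branch), so
`PeriodPair.IsReal.exists_Ioo_integral_eq_of_line` gives roots `m < M ≤ e₁ = ℘(Ω₀/2)` of
`f = 4x³ − g₂x − g₃` with `f > 0` on `(m, M)`; but for `disc < 0` one has `g₂ − 3e₁² < 0`
(`cubic_discr_eq_of_root`), the cofactor `4x² + 4e₁x + 4e₁² − g₂ = (2x + e₁)² + 3e₁² − g₂` is
positive and `f < 0` on `(−∞, e₁)` — contradiction at the midpoint of `(m, M)`. A deliberate
statement about Mathlib's `PeriodPair` (no new instance). [cite: Lawden1989, §6.16 (p. 179)] -/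
theorem isReal_I_mul_half_add_half_mem_of_discr_neg {L : PeriodPair} (h : L.IsReal)
    (hdisc : L.g₂.re ^ 3 - 27 * L.g₃.re ^ 2 < 0) :
    I * (((L.mulLeft I I_ne_zero).minRealPeriod / 2 : ℝ) : ℂ) + ((L.minRealPeriod / 2 : ℝ) : ℂ) ∈
      L.lattice := by
  set e₁ := L.weierstrassPRe (L.minRealPeriod / 2) with he₁_def
  set A := L.g₂.re with hA
  set B := L.g₃.re with hB
  have hΩ := h.minRealPeriod_pos
  have he₁ : 4 * e₁ ^ 3 - A * e₁ - B = 0 := h.cubic_weierstrassPRe_half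
  have hright : ∀ x, e₁ < x → 0 < 4 * x ^ 3 - A * x - B := fun x hx ↦ h.cubic_pos_of_lt hx
  set L' := L.mulLeft I I_ne_zero with hL'
  have h' : L'.IsReal := h.mulLeft_I
  have hΩ' := h'.minRealPeriod_pos
  set w : ℂ := I * ((L'.minRealPeriod / 2 : ℝ) : ℂ) with hw
  have h2w : 2 * w ∈ L.lattice := by
    have h1 : (L'.minRealPeriod : ℂ) ∈ L'.lattice := h'.minRealPeriod_mem_lattice
    rw [hL', PeriodPair.mem_mulLeft_lattice, Complex.inv_I] at h1
    have := neg_mem h1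
    convert this using 1
    rw [hw]; push_cast; ring
  have hcw : conj w = -w := by
    rw [hw, map_mul, Complex.conj_I, Complex.conj_ofReal]; ring
  have hw_notMem : w ∉ L.lattice := by
    intro hwmem
    have h1 : I * w ∈ L'.lattice := PeriodPair.mul_mem_mulLeft_lattice.mpr hwmem
    have h2 : ((L'.minRealPeriod / 2 : ℝ) : ℂ) ∈ L'.lattice := by
      have := neg_mem h1
      rw [hw, ← mul_assoc, Complex.I_mul_I] at this
      simpa using this
    have := h'.minRealPeriod_le ⟨by positivity, h2⟩
    linarith
  by_contra hcase
  -- the horizontal line `w + ℝ` misses `Λ`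
  have hline : ∀ t : ℝ, w + t ∉ L.lattice := by
    intro t ht
    have hct : -w + t ∈ L.lattice := by
      have := h _ ht
      rwa [map_add, hcw, Complex.conj_ofReal] at this
    have h2t : ((2 * t : ℝ) : ℂ) ∈ L.lattice := by
      convert add_mem ht hct using 1
      push_cast; ring
    obtain ⟨k, hk⟩ := h.exists_eq_int_mul h2t
    have hzmul : ∀ j : ℤ, ((j : ℝ) : ℂ) * (L.minRealPeriod : ℂ) ∈ L.lattice := by
      intro j
      have := zsmul_mem h.minRealPeriod_mem_lattice j
      rw [zsmul_eq_mul] at this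
      exact_mod_cast this
    rcases Int.even_or_odd k with ⟨j, rfl⟩ | ⟨j, rfl⟩
    · have ht' : t = j * L.minRealPeriod := by push_cast at hk; linarith
      have htmem : (t : ℂ) ∈ L.lattice := by
        rw [ht']; push_cast
        exact_mod_cast hzmul j
      exact hw_notMem (by simpa using sub_mem ht htmem)
    · have ht' : t = j * L.minRealPeriod + L.minRealPeriod / 2 := by push_cast at hk; linarith
      refine hcase ?_
      convert sub_mem ht (hzmul j) using 1
      rw [ht']; push_cast; ring
  obtain ⟨m, M, hmM, -, hfM, hfpos, -⟩ := h.exists_Ioo_integral_eq_of_line h2w hcw hline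
  have hMe : M ≤ e₁ := by
    by_contra hcon
    have := hright M (not_le.mp hcon)
    rw [hfM] at this
    exact lt_irrefl 0 this
  -- `disc < 0`: `f < 0` on `(-∞, e₁)`, contradicting `f > 0` at the midpoint of `(m, M)`
  have hD : A - 3 * e₁ ^ 2 < 0 := by
    rw [PeriodPair.cubic_discr_eq_of_root he₁] at hdisc
    by_contra hcon
    have := mul_nonneg (not_lt.mp hcon) (sq_nonneg (12 * e₁ ^ 2 - A))
    linarith
  set x := (m + M) / 2 with hx
  have hxm : m < x := by rw [hx]; linarith
  have hxM : x < M := by rw [hx]; linarith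
  have hfx : 0 < 4 * x ^ 3 - A * x - B := hfpos x ⟨hxm, hxM⟩
  have hxe : x < e₁ := lt_of_lt_of_le hxM hMe
  rw [PeriodPair.cubic_eq_mul_of_root he₁] at hfx
  have hq : 0 < 4 * x ^ 2 + 4 * e₁ * x + (4 * e₁ ^ 2 - A) := by
    nlinarith [sq_nonneg (2 * x + e₁)]
  have : (x - e₁) * (4 * x ^ 2 + 4 * e₁ * x + (4 * e₁ ^ 2 - A)) < 0 :=
    mul_neg_of_neg_of_pos (by linarith) hq
  linarith

/-! ### §2 The Néron lattice has a point of real part `Ω(W)/2`; optimal data have `Ω(W) = |c|·Ω⁺_f` -/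

variable {W : WeierstrassCurve ℚ} {N : ℕ} [NeZero N]

/-- **Some point of the Néron lattice has real part `Ω(W)/2`** (so, with the tree's
`ModularParametrizationData.exists_re_eq_int_mul_realPeriodRat_div_two`, `re Λ_E = ℤ · Ω(W)/2`;
Cremona §2.8, p. 26). Rectangular case `Δ > 0`: `Ω(W) = 2Ω₀` and `Ω₀ ∈ Λ_E`; rhombic case `Δ < 0`:
`Ω(W) = Ω₀` and `iΩ₀'/2 + Ω₀/2 ∈ Λ_E` (`isReal_I_mul_half_add_half_mem_of_discr_neg`).
[cite: CremonaAlgorithms1997, §2.8 (p. 26)] -/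
theorem exists_mem_re_eq_realPeriodRat_div_two [W.IsElliptic] (D : ModularParametrizationData W N) :
    ∃ z ∈ D.L.lattice, z.re = W.realPeriodRat / 2 := by
  haveI : (W.baseChange ℝ).IsElliptic := by rw [WeierstrassCurve.baseChange]; infer_instance
  rw [D.realPeriodRat_eq_numRealComponents_mul]
  by_cases hΔ : 0 < (W.baseChange ℝ).Δ
  · rw [(W.baseChange ℝ).numRealComponents_of_Δ_pos hΔ]
    refine ⟨(D.L.minRealPeriod : ℂ), D.isReal_neronLattice.minRealPeriod_mem_lattice, ?_⟩
    rw [Complex.ofReal_re]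
    push_cast
    ring
  · have hne : (W.baseChange ℝ).Δ ≠ 0 := (W.baseChange ℝ).isUnit_Δ.ne_zero
    have hneg : (W.baseChange ℝ).Δ < 0 := lt_of_le_of_ne (not_lt.mp hΔ) hne
    rw [(W.baseChange ℝ).numRealComponents_of_Δ_nonpos hneg.le]
    have hdisc : D.L.g₂.re ^ 3 - 27 * D.L.g₃.re ^ 2 < 0 := by
      rw [D.discr_neronLattice]; exact hneg
    refine ⟨_, isReal_I_mul_half_add_half_mem_of_discr_neg D.isReal_neronLattice hdisc, ?_⟩
    simp only [Complex.add_re, Complex.mul_re, Complex.I_re, Complex.I_im, Complex.ofReal_re,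
      Complex.ofReal_im, zero_mul, one_mul, zero_sub]
    push_cast
    ring

/-- **`Ω(W) = |c| · Ω⁺_f` for an OPTIMAL modular parametrisation datum** (`Λ_E ⊆ c · Λ_f`, the
rendering of "`W` is the `X₀(N)`-optimal curve and `D` its optimal parametrisation" used by the
tree's Manin facts `mazur_not_dvd_maninConstant_of_odd`, `cremona_abs_maninConstant_eq_one_of_level_le`,
…; Cremona §2.8 p. 26, §2.10; Edixhoven 1991 §1). Proof: a point `z ∈ Λ_E` with `re z = Ω(W)/2`
(`exists_mem_re_eq_realPeriodRat_div_two`) is `c·w` with `w ∈ Λ_f`, `re w ∈ ℤ·Ω⁺_f/2`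
(`realPeriods_eq_zmultiples_of_plusPeriod_pos`), so `Ω(W) = c k Ω⁺_f`, `k ∈ ℤ`; conversely
`c·Ω⁺_f/2 = re(c z₀) ∈ ℤ·Ω(W)/2` (`exists_re_eq_int_mul_realPeriodRat_div_two`), so
`c Ω⁺_f = j Ω(W)`; hence `jk = 1`, `k = ±1`, and `Ω(W), Ω⁺_f > 0` force `ck = |c|`.
[cite: CremonaAlgorithms1997, §2.8 (p. 26) and §2.10] [cite: EdixhovenManin1991, §1] -/
theorem realPeriodRat_eq_abs_maninConstant_mul_plusPeriod_of_optimal [W.IsElliptic]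
    (D : ModularParametrizationData W N)
    (hopt : ∀ z ∈ D.L.lattice, ∃ w ∈ periodLattice D.f, z = D.c * w) :
    W.realPeriodRat = |(D.c : ℝ)| * plusPeriod D.f := by
  haveI : (W.baseChange ℝ).IsElliptic := by rw [WeierstrassCurve.baseChange]; infer_instance
  have hpos : 0 < plusPeriod D.f :=
    IsNewform0.plusPeriod_pos_holds D.isNewformOf.1 D.isNewformOf.coeffField_eq_bot
  have hre : realPeriods D.f = AddSubgroup.zmultiples (plusPeriod D.f / 2) :=
    realPeriods_eq_zmultiples_of_plusPeriod_pos D.f hpos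
  have hΩpos : 0 < W.realPeriodRat := (W.baseChange ℝ).realPeriod_pos'
  have hc : (D.c : ℝ) ≠ 0 := Int.cast_ne_zero.mpr D.maninConstant_ne_zero_holds
  -- (1) `Ω(W) = c k Ω⁺_f`
  obtain ⟨z, hz, hzre⟩ := exists_mem_re_eq_realPeriodRat_div_two D
  obtain ⟨w, hw, hzw⟩ := hopt z hz
  have hwre : w.re ∈ realPeriods D.f := by
    rw [realPeriods, AddSubgroup.mem_map]
    exact ⟨w, hw, rfl⟩
  rw [hre, AddSubgroup.mem_zmultiples_iff] at hwre
  obtain ⟨k, hk⟩ := hwre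
  have h1 : W.realPeriodRat = (D.c : ℝ) * k * plusPeriod D.f := by
    have hzre' : z.re = (D.c : ℝ) * w.re := by
      rw [hzw, Complex.mul_re, Complex.intCast_re, Complex.intCast_im, zero_mul, sub_zero]
    rw [← hk, zsmul_eq_mul] at hzre'
    linarith
  -- (2) `c Ω⁺_f = j Ω(W)`
  have hmem : plusPeriod D.f / 2 ∈ realPeriods D.f := by
    rw [hre]; exact AddSubgroup.mem_zmultiples _
  rw [realPeriods, AddSubgroup.mem_map] at hmem
  obtain ⟨z₀, hz₀, hz₀re⟩ := hmem
  have hz₀re' : z₀.re = plusPeriod D.f / 2 := by simpa using hz₀re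
  obtain ⟨j, hj⟩ := D.exists_re_eq_int_mul_realPeriodRat_div_two (D.smul_periodLattice_le z₀ hz₀)
  have h2 : (D.c : ℝ) * plusPeriod D.f = j * W.realPeriodRat := by
    have hmul : ((D.c : ℂ) * z₀).re = (D.c : ℝ) * z₀.re := by
      rw [Complex.mul_re, Complex.intCast_re, Complex.intCast_im, zero_mul, sub_zero]
    rw [hmul, hz₀re'] at hj
    linarith
  -- (3) `j k = 1`, so `k = ±1` and `c k = |c|`
  have hjk : (j : ℝ) * k = 1 := by
    have key : (D.c : ℝ) * plusPeriod D.f * ((j : ℝ) * k) = (D.c : ℝ) * plusPeriod D.f * 1 := by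
      calc (D.c : ℝ) * plusPeriod D.f * ((j : ℝ) * k)
          = (j : ℝ) * ((D.c : ℝ) * k * plusPeriod D.f) := by ring
        _ = (j : ℝ) * W.realPeriodRat := by rw [← h1]
        _ = (D.c : ℝ) * plusPeriod D.f * 1 := by rw [← h2, mul_one]
    exact mul_left_cancel₀ (mul_ne_zero hc hpos.ne') key
  have hkj : k * j = 1 := by
    have : ((k * j : ℤ) : ℝ) = 1 := by push_cast; linarith [hjk]
    exact_mod_cast this
  have hckpos : 0 < (D.c : ℝ) * k := by
    have : 0 < (D.c : ℝ) * k * plusPeriod D.f := by rw [← h1]; exact hΩpos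
    exact (pos_iff_pos_of_mul_pos this).mpr hpos
  have hck : (D.c : ℝ) * k = |(D.c : ℝ)| := by
    rcases Int.eq_one_or_neg_one_of_mul_eq_one hkj with rfl | rfl
    · simp only [Int.cast_one, mul_one] at hckpos ⊢
      exact (abs_of_pos hckpos).symm
    · simp only [Int.cast_neg, Int.cast_one, mul_neg, mul_one] at hckpos ⊢
      exact (abs_of_neg (by linarith)).symm
  rw [h1, hck]

/-- **The period-transfer binder of the Kim facts, discharged by optimality**: for an optimal datum
`D` of a globally minimal elliptic `W/ℚ` and a prime `p ∤ c` (Kim's Manin hypothesis), `u := |c|`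
is a rational `p`-adic unit with `Ω(W) = u · Ω⁺_{D.f}`. [cite: CremonaAlgorithms1997, §2.8 (p. 26)]
[cite: Kim2022StructureSelmer, §1.3.5 (the Manin constant assumption at an additive prime)] -/
theorem periodTransfer_of_optimal [W.IsElliptic] (p : ℕ) [Fact p.Prime]
    (D : ModularParametrizationData W N)
    (hopt : ∀ z ∈ D.L.lattice, ∃ w ∈ periodLattice D.f, z = D.c * w)
    (hc : ¬ (p : ℤ) ∣ D.maninConstant) :
    ∃ u : ℚ, ‖(u : ℚ_[p])‖ = 1 ∧ W.realPeriodRat = u * plusPeriod D.f := by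
  refine ⟨((|D.c| : ℤ) : ℚ), ?_, ?_⟩
  · rw [Rat.cast_intCast]
    have hle : ‖((|D.c| : ℤ) : ℚ_[p])‖ ≤ 1 := Padic.norm_int_le_one _
    have hlt : ¬ ‖((|D.c| : ℤ) : ℚ_[p])‖ < 1 := by
      rw [Padic.norm_intCast_lt_one_iff]
      exact fun h => hc ((dvd_abs _ _).mp h)
    exact le_antisymm hle (not_lt.mp hlt)
  · rw [realPeriodRat_eq_abs_maninConstant_mul_plusPeriod_of_optimal D hopt]
    push_cast
    rfl

/-! ### §3 The Kim consumers of class X4 with the period binder discharged (per pair) -/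

variable (W' : WeierstrassCurve ℚ) [W'.IsElliptic] [W'.IsGloballyMinimal] (p : ℕ) [Fact p.Prime]

/-- **Rank `0`, ANY reduction at `p` (additive included), OPTIMAL curve**: Kim 2026 Thm. 1.8 (6)
(`hKim`) + Gross–Zagier–Kolyvagin (`hGZK`) with the period binder supplied by
`periodTransfer_of_optimal`: for `p ≥ 5`, `ρ̄` onto, `L(E,1) ≠ 0`, an OPTIMAL datum `D` with
`p ∤ D.c`, `p ∤ ∏ c_ℓ`, and ONE unit Kurihara number at a cyclic `𝒩₁`-level, Miller's `BSD(E,p)`.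
The remaining non-certificate input per pair is "`D` optimal with `p ∤ c`" — for a Cremona `…1`
curve of conductor `< 60000` the shape of Agashe–Ribet–Stein 2006 Thm. 5.2 + Thm. 2.6 (`|c| = 1`).
Per pair; NOT a class theorem. [cite: Kim2022StructureSelmer, Thm. 1.8 (6) and §1.3.5 (journal)]
[cite: AgasheRibetStein2006, Thm. 2.6 and appendix Thm. 5.2] [cite: Miller2011LMS, Def. 1.1] -/
theorem bsdp_of_kim_rankZero_of_optimal
    (hKim : Kim2022_rankZero_padicValRat_sha_of_kuriharaNumber_ne_zero_of_maninConstant)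
    (hGZK : rank_eq_analyticRank_of_analyticRank_le_one) (hp : 5 ≤ p)
    (hsurj : W'.HasSurjectiveModNGaloisRep p) (hL : W'.entireLFunction 1 ≠ 0)
    {N' : ℕ} [NeZero N'] (D : ModularParametrizationData W' N')
    (hopt : ∀ z ∈ D.L.lattice, ∃ w ∈ periodLattice D.f, z = D.c * w)
    (hc : ¬ (p : ℤ) ∣ D.maninConstant) (htam : ¬ p ∣ W'.tamagawaProduct)
    (n : ℕ) [NeZero n] (hn : Kato.IsKolyvaginProduct W' p 1 n)
    (hcyc : ∀ (ℓ : ℕ) [Fact ℓ.Prime], ℓ ∣ n →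
      Nat.card {P : ((WeierstrassCurve.integralModelInt W').map
          (Int.castRingHom (ZMod ℓ))).toAffine.Point // p • P = 0} ≤ p)
    (ψ : (ℓ : ℕ) → (ZMod ℓ)ˣ →* Multiplicative (ZMod (p ^ 1)))
    (hψ : ∀ ℓ ∈ n.primeFactors, Function.Surjective (ψ ℓ))
    (hδ : kuriharaNumber D.f (p ^ 1) n ψ ≠ 0) : BSDp W' p :=
  bsdp_of_kim_rankZero_of_maninConstant W' p hKim hGZK hp hsurj hL D hc
    (periodTransfer_of_optimal p D hopt hc) htam n hn hcyc ψ hψ hδ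

/-- **Rank `1`, ANY reduction at `p` (additive included), OPTIMAL curve**: Kim 2026 Thm. 1.8 (1),
(4), (6) (`hKim`) + GZK with the period binder supplied by `periodTransfer_of_optimal`: for
`p ≥ 5`, `ρ̄` onto, `L(E,1) = 0`, `r_an = 1`, an OPTIMAL datum `D` with `p ∤ D.c`, a unit Kurihara
number at a PRIME cyclic Kolyvagin level, and `#Ш_an = q` with `ord_p q = 0`, Miller's `BSD(E,p)`.
Per pair; NOT a class theorem. [cite: Kim2022StructureSelmer, Thm. 1.8 (1), (4), (6) and §1.3.5 (journal)]
[cite: AgasheRibetStein2006, Thm. 2.6 and appendix Thm. 5.2] [cite: Miller2011LMS, Def. 1.1] -/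
theorem bsdp_of_kim_rankOne_of_optimal
    (hKim : Kim2022_rankOne_card_sha_eq_one_of_kuriharaNumber_ne_zero_of_maninConstant)
    (hGZK : rank_eq_analyticRank_of_analyticRank_le_one) (hp : 5 ≤ p)
    (hsurj : W'.HasSurjectiveModNGaloisRep p) (hL : W'.entireLFunction 1 = 0)
    (hr : W'.analyticRank = 1)
    {N' : ℕ} [NeZero N'] (D : ModularParametrizationData W' N')
    (hopt : ∀ z ∈ D.L.lattice, ∃ w ∈ periodLattice D.f, z = D.c * w)
    (hc : ¬ (p : ℤ) ∣ D.maninConstant)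
    (ℓ : ℕ) [Fact ℓ.Prime] (hℓ : Kato.IsKolyvaginPrime W' p 1 ℓ)
    (hcyc : Nat.card {P : ((WeierstrassCurve.integralModelInt W').map
        (Int.castRingHom (ZMod ℓ))).toAffine.Point // p • P = 0} ≤ p)
    (ψ : (ℓ' : ℕ) → (ZMod ℓ')ˣ →* Multiplicative (ZMod (p ^ 1)))
    (hψ : Function.Surjective (ψ ℓ)) (hδ : kuriharaNumber D.f (p ^ 1) ℓ ψ ≠ 0)
    {q : ℚ} (hq : shaAn W' = (q : ℂ)) (hv : padicValRat p q = 0) : BSDp W' p :=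
  bsdp_of_kim_rankOne_of_maninConstant W' p hKim hGZK hp hsurj hL hr D hc
    (periodTransfer_of_optimal p D hopt hc) ℓ hℓ hcyc ψ hψ hδ hq hv

end Summit.BirchSwinnertonDyer.Rank1Residual.X4

end
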